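import Literature.Computability.AlgebraicComplexity.WordPolynomialRank
import Literature.Computability.AlgebraicComplexity.CircuitGateSemantics
import HarnessLib

/-!
# Words with arbitrary letter sizes: definitions (general form of the LST word machinery)

(N. Limaye, S. Srinivasan, S. Tavenas, *Superpolynomial lower bounds against low-depth algebraic
circuits*, J. ACM 72 (2025), Art. 26, §2.2 (the word polynomial `P_w` of a word `w ∈ ℤ^d`,
`w_i ≠ 0`), Lemma 22 (the width-`2^{|w_{[t]}|}` automaton for `P_w`) and the proof of Lemma 8;
V. Bhargav, P. Dutta, N. Saxena, ACM Trans. Comput. Theory 16 (2024), Art. 22, §4 (the word with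
letters `αk = (1 - p₀/q₀)k` and `-k`).)

`UnbiasedWords.lean`, `WordAutomaton.lean`, `WordPolynomialRank.lean` (namespace `LSTWord`) fix
the letter sizes to `⌊k/√2⌋` (positive) and `k` (negative) through `letterSize k pos`.  The
lower bound of Bhargav–Dutta–Saxena needs the two letter sizes `(q₀ - p₀)t` and `q₀ t`, and LST's
§2 is written for an ARBITRARY word.  This file carries the DEFINITIONS of that general form: a
word is a size function `sz : Fin d → ℕ` (`|w_i| = sz i`) and a sign pattern `pos : Fin d → Bool`;
block `i` has the `2^{sz i}` variables `BlockVar sz i = (Fin (sz i) → Bool)`.  Everything else is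
the verbatim analogue of the `LSTWord` development (whose objects are the instance
`sz = letterSize k pos`, definitionally), and the generic pieces (`Compat`, `bitsEquivFin`,
`posBlocks`/`negBlocks`, `LayeredAutomaton`, `relRank`) are reused, not copied:

* `wt`, `wsum` — the signed letters `±sz i` and the sums `w_S`; `letterSize₂ kp kn pos` — the
  two-letter size function; `greedyAcc₂`, `greedyWord₂` — the greedy sign pattern keeping the
  prefix sums in `[-kn, kp]` (LST Lemma 13/15 with a general positive letter);
* `stream`, `streamLen`, `overLen`, `overhang` — the positive/negative streams of an assignment
  and the overhang (LST Lemma 22); `castVec`, `wordStep`, `wordStart`, `wordEnc` — the queue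
  automaton, here with a DYNAMIC length check in `wordStep` (its success is a theorem of the
  sequel, `GenWordAutomaton.lean`, not a proof obligation inside the definition);
* `wordPoly sz pos K = P_w`, `wordSubst` — the substitution turning `IMM_{n,d}` into `P_w`;
* `glue`, `fullMono`, `rowStream`, `colStream` — rows/columns of `M_w(P_w)` (for the rank file);
* `InL g P p x` — "`x` is the value of a gate of product-depth `≤ p` of the circuit `P` under the
  substitution `g`, or a leaf" (the induction class of LST Claim 16), for any variable type.

Definitions only (all proofs are in the sequel files); no instances, no notation.

## References

* N. Limaye, S. Srinivasan, S. Tavenas, J. ACM 72 (2025), Art. 26, §2.2 (p. 26:9), Lemma 13,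
  Lemma 22, proof of Lemma 8, Claim 16.
* V. Bhargav, P. Dutta, N. Saxena, ACM ToCT 16 (2024), Art. 22, §4.1 (= MFCS 2022, LIPIcs 241:18).
-/

noncomputable section

open MvPolynomial

namespace Literature.Computability.AlgebraicComplexity

namespace GenWord

universe u

/-! ### Letters -/

section Letters

variable {d : ℕ} (sz : Fin d → ℕ) (pos : Fin d → Bool)

/-- The signed letter `w_i`: `+sz i` at a positive position, `-sz i` at a negative one
(LST 2025, §2: a word `w ∈ ℤ^d`). [cite: LimayeSrinivasanTavenas2025, §2.2] -/
def wt (i : Fin d) : ℤ := if pos i then (sz i : ℤ) else -(sz i : ℤ)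

/-- `w_S = ∑_{i ∈ S} w_i` (LST 2025, §2). [cite: LimayeSrinivasanTavenas2025, §2.2] -/
def wsum (S : Finset (Fin d)) : ℤ := ∑ i ∈ S, wt sz pos i

/-- The block variables: block `i` is labelled by the bit-strings of length `|w_i| = sz i`
(LST 2025, §2.2). [cite: LimayeSrinivasanTavenas2025, §2.2] -/
abbrev BlockVar (i : Fin d) : Type := Fin (sz i) → Bool

end Letters

/-- The two-letter size function: `kp` at positive positions, `kn` at negative ones (LST: `⌊k/√2⌋`
and `k`; BDS: `(q₀ - p₀)t` and `q₀ t`). [cite: BhargavDuttaSaxena2024, §4.1] -/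
def letterSize₂ {d : ℕ} (kp kn : ℕ) (pos : Fin d → Bool) (i : Fin d) : ℕ := if pos i then kp else kn

/-- The running prefix sum of the greedy word with letters `kp`, `-kn`: add `kp` if the current
sum is `≤ 0`, else add `-kn` (LST 2025, proof of Lemma 13). [cite: LimayeSrinivasanTavenas2025, Lemma 13] -/
def greedyAcc₂ (kp kn : ℕ) (t : ℕ) : ℤ :=
  Nat.rec (motive := fun _ => ℤ) 0 (fun _ acc => acc + (if acc ≤ 0 then (kp : ℤ) else -(kn : ℤ))) t

/-- The greedy sign pattern of length `d`: position `i` is positive iff the prefix sum before it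
is `≤ 0` (LST 2025, Lemma 13/15). [cite: LimayeSrinivasanTavenas2025, Lemma 15] -/
def greedyWord₂ (d kp kn : ℕ) : Fin d → Bool := fun i => decide (greedyAcc₂ kp kn i ≤ 0)

/-! ### Streams and the overhang -/

section Streams

variable {d : ℕ} (sz : Fin d → ℕ) (pos : Fin d → Bool)

/-- The stream of sign `sgn` after the first `t` blocks of the assignment `w`: the concatenation
of the labels of the blocks `i < t` with `pos i = sgn` (LST 2025, §2.2, `σ(m⁺)` and `σ(m⁻)`).
[cite: LimayeSrinivasanTavenas2025, §2.2] -/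
def stream (sgn : Bool) (w : (i : Fin d) → BlockVar sz i) (t : ℕ) : List Bool :=
  Nat.rec (motive := fun _ => List Bool) []
    (fun t acc => acc ++
      (if h : t < d then (if pos ⟨t, h⟩ = sgn then List.ofFn (w ⟨t, h⟩) else []) else [])) t

/-- The length of the stream of sign `sgn` after `t` blocks (independent of the assignment).
[cite: LimayeSrinivasanTavenas2025, §2.2] -/
def streamLen (sgn : Bool) (t : ℕ) : ℕ :=
  Nat.rec (motive := fun _ => ℕ) 0
    (fun t acc => acc + (if h : t < d then (if pos ⟨t, h⟩ = sgn then sz ⟨t, h⟩ else 0) else 0)) t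

/-- The *overhang length* after `t` blocks: `|w_{[t]}|`, the absolute difference of the stream
lengths (LST 2025, Lemma 22). [cite: LimayeSrinivasanTavenas2025, Lemma 22] -/
def overLen (t : ℕ) : ℕ :=
  (streamLen sz pos true t - streamLen sz pos false t) +
    (streamLen sz pos false t - streamLen sz pos true t)

/-- The *overhang* after `t` blocks: the part of the longer stream beyond the shorter one
(LST 2025, Lemma 22, the string `τ` kept by the vertex `v_τ`).
[cite: LimayeSrinivasanTavenas2025, Lemma 22] -/
def overhang (w : (i : Fin d) → BlockVar sz i) (t : ℕ) : List Bool :=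
  if streamLen sz pos false t ≤ streamLen sz pos true t then
    (stream sz pos true w t).drop (streamLen sz pos false t)
  else (stream sz pos false w t).drop (streamLen sz pos true t)

end Streams

/-! ### The queue automaton (LST 2025, Lemma 22) -/

section Automaton

variable {d : ℕ} (sz : Fin d → ℕ) (pos : Fin d → Bool)

/-- A bit-string as a vector of prescribed length, if it has that length. [folklore] -/
def castVec (l : List Bool) (m : ℕ) : Option (List.Vector Bool m) :=
  if h : l.length = m then some ⟨l, h⟩ else none

/-- **The transition of the queue automaton** at layer `t` (LST 2025, proof of Lemma 22): the
state is the current overhang; reading the label `b` of block `t`,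
* if block `t` lies on the longer (or equally long) side, push: the new overhang is `o ++ b`;
* otherwise compare `b` with the oldest overhang bits: reject unless they are compatible, and
  the new overhang is what remains of `o` (if `|b| ≤ |o|`) or of `b` (if `|b| > |o|`).
The length bookkeeping is a dynamic check (`castVec`), shown never to fail in the sequel.
[cite: LimayeSrinivasanTavenas2025, Lemma 22] -/
def wordStep (t : Fin d) (o : List.Vector Bool (overLen sz pos t)) (b : BlockVar sz t) :
    Option (List.Vector Bool (overLen sz pos (t.val + 1))) :=
  if streamLen sz pos (!pos t) t ≤ streamLen sz pos (pos t) t then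
    castVec (o.1 ++ List.ofFn b) _
  else if LSTWord.Compat (List.ofFn b) o.1 then
    castVec (if sz t ≤ overLen sz pos t then o.1.drop (sz t) else (List.ofFn b).drop (overLen sz pos t)) _
  else none

/-- The start state: the empty overhang. [cite: LimayeSrinivasanTavenas2025, Lemma 22] -/
def wordStart : List.Vector Bool (overLen sz pos 0) := ⟨[], rfl⟩

variable {n : ℕ} (hn : ∀ t ≤ d, 2 ^ overLen sz pos t ≤ n)

/-- **The state encodings**: the overhangs of layer `t` (bit-strings of length `|w_{[t]}|`) embed
into `Fin n` as soon as `2^{|w_{[t]}|} ≤ n` (LST 2025, Lemma 22: width `2^b`).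
[cite: LimayeSrinivasanTavenas2025, Lemma 22] -/
def wordEnc (t : ℕ) (o : List.Vector Bool (overLen sz pos t)) : Fin n :=
  if h : t ≤ d then Fin.castLE (hn t h) (LSTWord.bitsEquivFin _ o)
  else Fin.castLE (hn 0 (Nat.zero_le d)) ⟨0, Nat.two_pow_pos _⟩

end Automaton

/-! ### The word polynomial and the substitution -/

section WordPoly

variable {d : ℕ} (sz : Fin d → ℕ) (pos : Fin d → Bool) (K : Type u) [CommSemiring K]

/-- **The word polynomial `P_w`** (LST 2025, §2.2, p. 26:9): the sum of the set-multilinear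
monomials `m` over `X(w)` with `σ(m⁺) ∼ σ(m⁻)`. [cite: LimayeSrinivasanTavenas2025, §2.2] -/
def wordPoly : MvPolynomial (Σ i : Fin d, BlockVar sz i) K :=
  ∑ w : (i : Fin d) → BlockVar sz i,
    if LSTWord.Compat (stream sz pos true w d) (stream sz pos false w d) then ∏ i : Fin d, X ⟨i, w i⟩
    else 0

variable {n : ℕ} (hn : ∀ t ≤ d, 2 ^ overLen sz pos t ≤ n)

/-- **The substitution `ρ`** turning `IMM_{n,d}` into `P_w` (LST 2025, proof of Lemma 8): the
`IMM` variable `x^{(t)}_{e,e'}` goes to the sum of the labels of block `t` that move the queue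
automaton from the overhang encoded by `e` to the overhang encoded by `e'`.
[cite: LimayeSrinivasanTavenas2025, Lemma 8] -/
def wordSubst : Fin d × Fin n × Fin n → MvPolynomial (Σ i : Fin d, BlockVar sz i) K :=
  LayeredAutomaton.autSubst (St := fun t => List.Vector Bool (overLen sz pos t))
    (wordStart sz pos) (wordStep sz pos) (wordEnc sz pos hn)

end WordPoly

/-! ### Rows and columns of `M_w(P_w)` -/

section Rows

variable {d : ℕ} (sz : Fin d → ℕ) (pos : Fin d → Bool)

/-- Gluing a row assignment (on the positive blocks) and a column assignment (on the negative
blocks) to a full assignment. [cite: LimayeSrinivasanTavenas2025, §2.1] -/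
def glue (r : Assignment (BlockVar sz) (LSTWord.posBlocks pos))
    (c : Assignment (BlockVar sz) (LSTWord.negBlocks pos)) : (i : Fin d) → BlockVar sz i :=
  fun i =>
    if h : pos i = true then r ⟨i, Finset.mem_filter.2 ⟨Finset.mem_univ i, h⟩⟩
    else c ⟨i, Finset.mem_filter.2 ⟨Finset.mem_univ i, (congrArg not (Bool.of_not_eq_true h)).trans rfl⟩⟩

/-- The exponent vector of the full set-multilinear monomial `∏_i x_{i, w i}`. [folklore] -/
def fullMono (w : (i : Fin d) → BlockVar sz i) : (Σ i : Fin d, BlockVar sz i) →₀ ℕ :=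
  ∑ i : Fin d, Finsupp.single ⟨i, w i⟩ 1

/-- The positive stream `σ(r)` of a row assignment (as a bit-string; its length is the full
positive stream length). [cite: LimayeSrinivasanTavenas2025, §2.2] -/
def rowStream (r : Assignment (BlockVar sz) (LSTWord.posBlocks pos)) : List Bool :=
  stream sz pos true (glue sz pos r fun _ => default) d

/-- The negative stream `σ(c)` of a column assignment. [cite: LimayeSrinivasanTavenas2025, §2.2] -/
def colStream (c : Assignment (BlockVar sz) (LSTWord.negBlocks pos)) : List Bool :=
  stream sz pos false (glue sz pos (fun _ => default) c) d

end Rows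

/-! ### The induction class of LST's Claim 16 -/

section Induction

variable {K : Type u} [CommSemiring K] {σ τ : Type*}

/-- `InL g P p x`: `x` is the value, under the substitution `g` of the inputs, of a gate of the
circuit `P` of product-depth at most `p`, or a leaf (`g v` or a constant) — the objects the
depth induction of LST 2025, Claim 16 quantifies over. [cite: LimayeSrinivasanTavenas2025, Claim 16] -/
def InL (g : σ → MvPolynomial τ K) (P : ArithCircuit K σ) (p : ℕ) (x : MvPolynomial τ K) : Prop :=
  (∃ j, P.gatePD j ≤ p ∧ x = aeval g (P.gateVal j)) ∨ (∃ v, x = g v) ∨ (∃ c : K, x = C c)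

end Induction

end GenWord

end Literature.Computability.AlgebraicComplexity
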